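import Literature.NumberTheory.LFunctions.Zhang2022.Section8ProfileSjExact
import Literature.NumberTheory.LFunctions.Zhang2022.Section8XiDipoleSuppliers
import HarnessLib

/-!
# Zhang (2022) §8 p. 47: CRUDE BOUNDS for the two inner sums of `S_j` at profile data (the sliver `P^θ/T² ≤ dr < P^θ`
# of the gathering, where Lemmas 8.2/8.4 do not apply), and the absolute logarithmic mean of `ξ₀ⱼ` up to `log x ≤ 𝓛²`

Topic `Literature/NumberTheory/LFunctions/Zhang2022` (Landau–Siegel audit tree; verdict-neutral). Y. Zhang, *Discrete mean
estimates and the Landau–Siegel zero*, arXiv:2211.02515v1 (2022) [Zhang2022LandauSiegel] — **an unrefereed manuscript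
under adjudication; nothing here asserts or denies its Theorems 1–2; no claim about Landau–Siegel zeros.** Cell
landau-siegel §D, crux K0 = stmt-Parity-20459 (row (S)), prover ls-knife-K0-p1 g2. Profile-data twin of the tail-range
bookkeeping of `Section8FrontEnd44Sizes` (`norm_msum_tail_le`, `norm_nsum_tail_le`, there for Zhang's `ϰ₁, ϰ₂`):

* `norm_le_mul_sub_of_vanish` — a `C¹` piece with `u(θ) = 0`, `‖u′‖ ≤ B₁` has `‖u(z)‖ ≤ B₁(θ − z)` on `[0,θ]`;
* `norm_psiSum_le_crude` — `‖M_j(t)‖ ≤ B₁Z(1 + ZΛ)`, `Z = θ − log t/Λ` (`Λ = 𝓛⁹`; the window `m ≤ e^{ZΛ}` has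
  `‖u(z_t + z_m)‖ ≤ B₁Z` and `Σ 1/m ≤ 1 + ZΛ`);
* `norm_antiSum_le_crude` — `‖N_j(d,r)‖ ≤ B₁Z·Σ_{n<⌈e^{ZΛ}⌉}‖ξ₀ⱼ(n;d,r)‖/n`;
* `xiZeroLogMean_le` — `Σ_{n<⌈x⌉}‖ξ₀ⱼ(n;d,r)‖/n ≤ C(1 + log x)³` for `1 ≤ x`, `log x ≤ 𝓛²` (the tree's
  `XiZeroMajorant.xiZeroTailMean_logFree`, whose proof uses `x ≤ T` only through `log x ≤ 𝓛²`; needed up to `x = T²`).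

## References
* Y. Zhang, arXiv:2211.02515v1 (2022), §8 p. 47 (display before (8.10)); §7 p. 33. [cite: Zhang2022LandauSiegel, §8 p.47]
* R. R. Hall, G. Tenenbaum, *Divisors* (CUP 1988), (0.4). [cite: HallTenenbaum1988, (0.4)]
-/

noncomputable section

open Complex Real Finset MeasureTheory Set
open scoped ComplexConjugate

namespace Literature.NumberTheory.LFunctions.Zhang2022.DipoleRule

open Skeleton KnifeEdge

/-! ### A `C¹` piece vanishing at `θ` is `O(θ − z)` -/

/-- **`‖u(z)‖ ≤ B₁(θ − z)` on `[0,θ]`** for `u` continuous on `[0,θ]`, differentiable on `[0,θ)` with `‖u′‖ ≤ B₁`, `u(θ) = 0`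
(mean value inequality on `[z, θ]`). [cite: Zhang2022LandauSiegel, §8 Lemma 8.2 p.45] -/
theorem norm_le_mul_sub_of_vanish {u u' : ℝ → ℂ} {θ B₁ : ℝ} (hu : ContinuousOn u (Icc 0 θ))
    (hd : ∀ y ∈ Ico 0 θ, HasDerivAt u (u' y) y) (huθ : u θ = 0) (hB1 : ∀ y ∈ Icc 0 θ, ‖u' y‖ ≤ B₁)
    {z : ℝ} (hz : z ∈ Icc 0 θ) : ‖u z‖ ≤ B₁ * (θ - z) := by
  have h := norm_image_sub_le_of_norm_deriv_right_le_segment (f := u) (f' := u') (a := z) (b := θ) (C := B₁)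
    (hu.mono (Icc_subset_Icc hz.1 le_rfl))
    (fun x hx => (hd x ⟨hz.1.trans hx.1, hx.2⟩).hasDerivWithinAt)
    (fun x hx => hB1 x ⟨hz.1.trans hx.1, hx.2.le⟩) θ (right_mem_Icc.mpr hz.2)
  rwa [huθ, zero_sub, norm_neg] at h

/-! ### Harmonic bookkeeping -/

/-- `Σ_{1 ≤ m < ⌈x⌉} 1/m ≤ 1 + log x` for `x ≥ 1`. [folklore] -/
private theorem sum_Ico_one_ceil_inv_le' {x : ℝ} (hx : 1 ≤ x) :
    ∑ m ∈ Finset.Ico 1 ⌈x⌉₊, (m : ℝ)⁻¹ ≤ 1 + Real.log x := by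
  have hn : ⌈x⌉₊ - 1 ≤ ⌊x⌋₊ := by
    have h1 : ⌈x⌉₊ ≤ ⌊x⌋₊ + 1 := Nat.ceil_le_floor_add_one x
    omega
  have hx0 : 0 ≤ x := by linarith
  calc ∑ m ∈ Finset.Ico 1 ⌈x⌉₊, (m : ℝ)⁻¹
      ≤ ∑ m ∈ Finset.Icc 1 ⌊x⌋₊, (m : ℝ)⁻¹ := by
        apply Finset.sum_le_sum_of_subset_of_nonneg
        · intro m hm
          rw [Finset.mem_Ico] at hm
          rw [Finset.mem_Icc]; omega
        · intros; positivity
    _ = (harmonic ⌊x⌋₊ : ℝ) := by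
        rw [harmonic_eq_sum_Icc]; push_cast; rfl
    _ ≤ 1 + Real.log ⌊x⌋₊ := harmonic_le_one_add_log _
    _ ≤ 1 + Real.log x := by
        rcases Nat.eq_zero_or_pos ⌊x⌋₊ with h0 | h0
        · rw [h0]; simp [Real.log_nonneg hx]
        · have : (⌊x⌋₊ : ℝ) ≤ x := Nat.floor_le hx0
          have hpos : (0 : ℝ) < ⌊x⌋₊ := by exact_mod_cast h0
          linarith [Real.log_le_log hpos this]

/-- `Σ_{m ∈ Ioc 0 ⌊x⌋} 1/m ≤ 1 + log x` for `x ≥ 1`. [folklore] -/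
private theorem sum_Ioc_zero_floor_inv_le {x : ℝ} (hx : 1 ≤ x) :
    ∑ m ∈ Finset.Ioc 0 ⌊x⌋₊, (m : ℝ)⁻¹ ≤ 1 + Real.log x := by
  have hx0 : 0 ≤ x := by linarith
  have hIcc : Finset.Ioc 0 ⌊x⌋₊ = Finset.Icc 1 ⌊x⌋₊ := by
    ext m; simp only [Finset.mem_Ioc, Finset.mem_Icc]; omega
  rw [hIcc]
  calc ∑ m ∈ Finset.Icc 1 ⌊x⌋₊, (m : ℝ)⁻¹ = (harmonic ⌊x⌋₊ : ℝ) := by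
        rw [harmonic_eq_sum_Icc]; push_cast; rfl
    _ ≤ 1 + Real.log ⌊x⌋₊ := harmonic_le_one_add_log _
    _ ≤ 1 + Real.log x := by
        rcases Nat.eq_zero_or_pos ⌊x⌋₊ with h0 | h0
        · rw [h0]; simp [Real.log_nonneg hx]
        · have : (⌊x⌋₊ : ℝ) ≤ x := Nat.floor_le hx0
          have hpos : (0 : ℝ) < ⌊x⌋₊ := by exact_mod_cast h0
          linarith [Real.log_le_log hpos this]

/-! ### The `ψ`-side inner sum on the sliver -/

/-- `‖e^{γz}‖ = 1` for purely imaginary `γ`. [folklore] -/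
private theorem norm_exp_mul_of_re_zero {γ : ℂ} (hγ : γ.re = 0) (z : ℝ) : ‖Complex.exp (γ * (z : ℂ))‖ = 1 := by
  rw [Complex.norm_exp]
  simp [Complex.mul_re, hγ]

/-- `Re β_j = 0`. [cite: Zhang2022LandauSiegel, §2 (2.13)] -/
private theorem betaJ_re' (c' : ℝ) (D : ℕ) (j : ℕ) : (betaJ c' D j).re = 0 := by
  unfold betaJ beta1 beta2 beta3
  split_ifs <;> simp

/-- **CRUDE BOUND FOR `M_j(t)`** (`1 ≤ t ≤ e^{θΛ} < ⌈PT⁻²⌉`, `Λ = 𝓛⁹ > 0`, `u = 0` on `[θ,∞)` with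
`‖u(z)‖ ≤ B₁(θ − z)` on `[0,θ]`): `‖M_j(t)‖ ≤ B₁·Z·(1 + ZΛ)` where `Z = θ − log t/Λ` (so `e^{ZΛ} = e^{θΛ}/t`).
[cite: Zhang2022LandauSiegel, §8 p.47 (display before (8.10))] -/
theorem norm_psiSum_le_crude {D : ℕ} (χ : DirichletCharacter ℂ D) (c' : ℝ) (j : ℕ) {u : ℝ → ℂ} {θ B₁ : ℝ}
    (hvan : ∀ y : ℝ, θ ≤ y → u y = 0) (hB : ∀ z ∈ Icc 0 θ, ‖u z‖ ≤ B₁ * (θ - z)) (hB1 : 0 ≤ B₁)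
    (hℓ : 0 < Real.log D) {t : ℕ} (ht : 1 ≤ t) (htθ : (t : ℝ) ≤ Real.exp (θ * Real.log D ^ 9))
    (hθN : Real.exp (θ * Real.log D ^ 9) < Nsupp D) :
    ‖psiSum c' D χ j u t‖ ≤ B₁ * (θ - Real.log t / Real.log D ^ 9) *
      (1 + (θ - Real.log t / Real.log D ^ 9) * Real.log D ^ 9) := by
  set Λ : ℝ := Real.log D ^ 9 with hΛ
  set z₀ : ℝ := Real.log t / Λ with hz₀
  set Z : ℝ := θ - z₀ with hZ
  have hΛ0 : 0 < Λ := by positivity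
  have ht0 : (0 : ℝ) < t := by exact_mod_cast ht
  have hz₀0 : 0 ≤ z₀ := div_nonneg (Real.log_nonneg (by exact_mod_cast ht)) hΛ0.le
  -- `z₀ ≤ θ`, i.e. `Z ≥ 0`, from `t ≤ e^{θΛ}`
  have hZ0 : 0 ≤ Z := by
    have : Real.log t ≤ θ * Λ := by
      rw [← Real.log_exp (θ * Λ)]; exact Real.log_le_log ht0 htθ
    have : z₀ ≤ θ := by rw [hz₀, div_le_iff₀ hΛ0]; exact this
    linarith
  have hx1 : 1 ≤ Real.exp (Z * Λ) := Real.one_le_exp (mul_nonneg hZ0 hΛ0.le)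
  -- g0's identity: `M_j(t) = χ(t)·Σ_{m ≤ e^{ZΛ}} χ(m)m⁻¹V_t(z_m)`
  have hid := sjInner_psi_eq χ c' j hvan hℓ ht hθN
  have hpsi : psiSum c' D χ j u t
      = χ (t : ZMod D) * ∑ m ∈ Finset.Ioc 0 ⌊Real.exp (Z * Λ)⌋₊,
          χ (m : ZMod D) * (m : ℂ)⁻¹ * shiftTwist (betaJ c' D j * Real.log D ^ 9) u z₀ (Real.log m / Λ) := by
    unfold psiSum; rw [hid]
  rw [hpsi, norm_mul]
  have hχt : ‖χ (t : ZMod D)‖ ≤ 1 := χ.norm_le_one _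
  have hγ : (betaJ c' D j * Real.log D ^ 9 : ℂ).re = 0 := by
    rw [show (betaJ c' D j * Real.log D ^ 9 : ℂ) = betaJ c' D j * ((Real.log D ^ 9 : ℝ) : ℂ) by push_cast; ring,
      Complex.mul_re, betaJ_re', Complex.ofReal_im]
    ring
  -- termwise bound `≤ B₁Z/m`
  have hterm : ∀ m ∈ Finset.Ioc 0 ⌊Real.exp (Z * Λ)⌋₊,
      ‖χ (m : ZMod D) * (m : ℂ)⁻¹ * shiftTwist (betaJ c' D j * Real.log D ^ 9) u z₀ (Real.log m / Λ)‖
        ≤ B₁ * Z * (m : ℝ)⁻¹ := by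
    intro m hm
    rw [Finset.mem_Ioc] at hm
    have hm1 : 1 ≤ m := hm.1
    have hm0 : (0 : ℝ) < m := by exact_mod_cast hm1
    have hmx : (m : ℝ) ≤ Real.exp (Z * Λ) := le_trans (by exact_mod_cast hm.2) (Nat.floor_le (by positivity))
    have hzm0 : 0 ≤ Real.log m / Λ := div_nonneg (Real.log_nonneg (by exact_mod_cast hm1)) hΛ0.le
    have hzmZ : Real.log m / Λ ≤ Z := by
      rw [div_le_iff₀ hΛ0, ← Real.log_exp (Z * Λ)]; exact Real.log_le_log hm0 hmx
    have hmem : z₀ + Real.log m / Λ ∈ Icc 0 θ := ⟨by linarith, by linarith⟩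
    have hu := hB _ hmem
    unfold shiftTwist
    rw [norm_mul, norm_mul, norm_mul, norm_exp_mul_of_re_zero hγ, one_mul, norm_inv, Complex.norm_natCast]
    calc ‖χ (m : ZMod D)‖ * (m : ℝ)⁻¹ * ‖u (z₀ + Real.log m / Λ)‖
        ≤ 1 * (m : ℝ)⁻¹ * (B₁ * (θ - (z₀ + Real.log m / Λ))) := by
          gcongr; exact χ.norm_le_one _
      _ ≤ 1 * (m : ℝ)⁻¹ * (B₁ * Z) := by
          gcongr; linarith
      _ = B₁ * Z * (m : ℝ)⁻¹ := by ring
  have hsum : ‖∑ m ∈ Finset.Ioc 0 ⌊Real.exp (Z * Λ)⌋₊,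
      χ (m : ZMod D) * (m : ℂ)⁻¹ * shiftTwist (betaJ c' D j * Real.log D ^ 9) u z₀ (Real.log m / Λ)‖
        ≤ B₁ * Z * (1 + Z * Λ) := by
    calc _ ≤ ∑ m ∈ Finset.Ioc 0 ⌊Real.exp (Z * Λ)⌋₊, B₁ * Z * (m : ℝ)⁻¹ := (norm_sum_le _ _).trans (sum_le_sum hterm)
      _ = B₁ * Z * ∑ m ∈ Finset.Ioc 0 ⌊Real.exp (Z * Λ)⌋₊, (m : ℝ)⁻¹ := by rw [Finset.mul_sum]
      _ ≤ B₁ * Z * (1 + Real.log (Real.exp (Z * Λ))) :=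
          mul_le_mul_of_nonneg_left (sum_Ioc_zero_floor_inv_le hx1) (mul_nonneg hB1 hZ0)
      _ = B₁ * Z * (1 + Z * Λ) := by rw [Real.log_exp]
  calc ‖χ (t : ZMod D)‖ * _ ≤ 1 * (B₁ * Z * (1 + Z * Λ)) := mul_le_mul hχt hsum (norm_nonneg _) zero_le_one
    _ = B₁ * (θ - Real.log t / Real.log D ^ 9) * (1 + (θ - Real.log t / Real.log D ^ 9) * Real.log D ^ 9) := by
        rw [one_mul]

/-! ### The anti-side inner sum on the sliver -/

/-- **CRUDE BOUND FOR `N_j(d,r)`** (quadratic `χ`, `t = dr`, `1 ≤ t ≤ e^{θΛ} < ⌈PT⁻²⌉`, `‖u(z)‖ ≤ B₁(θ − z)` on `[0,θ]`):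
`‖N_j(d,r)‖ ≤ B₁·Z·Σ_{1≤n<⌈e^{ZΛ}⌉} ‖ξ₀ⱼ(n;d,r)‖/n`, `Z = θ − log t/Λ`.
[cite: Zhang2022LandauSiegel, §8 p.47 (display before (8.10))] -/
theorem norm_antiSum_le_crude {D : ℕ} (χ : DirichletCharacter ℂ D) (hq : χ.IsQuadratic) (c' : ℝ) (j d r : ℕ)
    {u : ℝ → ℂ} {θ B₁ : ℝ} (hvan : ∀ y : ℝ, θ ≤ y → u y = 0) (hB : ∀ z ∈ Icc 0 θ, ‖u z‖ ≤ B₁ * (θ - z))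
    (hB1 : 0 ≤ B₁) (hℓ : 0 < Real.log D) (ht : 1 ≤ d * r) (htθ : ((d * r : ℕ) : ℝ) ≤ Real.exp (θ * Real.log D ^ 9))
    (hθN : Real.exp (θ * Real.log D ^ 9) < Nsupp D) :
    ‖antiSum c' D χ j u d r‖ ≤ B₁ * (θ - Real.log ((d * r : ℕ) : ℝ) / Real.log D ^ 9) *
      ∑ n ∈ Finset.Ico 1 ⌈Real.exp ((θ - Real.log ((d * r : ℕ) : ℝ) / Real.log D ^ 9) * Real.log D ^ 9)⌉₊,
        ‖xiZero c' D j n d r‖ / n := by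
  set t : ℕ := d * r with htdef
  set Λ : ℝ := Real.log D ^ 9 with hΛ
  set z₀ : ℝ := Real.log (t : ℝ) / Λ with hz₀
  set Z : ℝ := θ - z₀ with hZ
  have hΛ0 : 0 < Λ := by positivity
  have ht0 : (0 : ℝ) < t := by exact_mod_cast ht
  have hz₀0 : 0 ≤ z₀ := div_nonneg (Real.log_nonneg (by exact_mod_cast ht)) hΛ0.le
  have hZ0 : 0 ≤ Z := by
    have : Real.log (t : ℝ) ≤ θ * Λ := by
      rw [← Real.log_exp (θ * Λ)]; exact Real.log_le_log ht0 htθ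
    have : z₀ ≤ θ := by rw [hz₀, div_le_iff₀ hΛ0]; exact this
    linarith
  have hid := sjInner_anti_eq χ hq c' j d r hvan hℓ ht hθN
  have hanti : antiSum c' D χ j u d r
      = χ (t : ZMod D) * ∑ n ∈ Finset.Ico 1 ⌈Real.exp (Z * Λ)⌉₊,
          χ (n : ZMod D) * xiZero c' D j n d r / (n : ℂ) * conj (u (z₀ + Real.log n / Λ)) := by
    unfold antiSum; rw [hid]
  rw [hanti, norm_mul]
  have hχt : ‖χ (t : ZMod D)‖ ≤ 1 := χ.norm_le_one _
  have hterm : ∀ n ∈ Finset.Ico 1 ⌈Real.exp (Z * Λ)⌉₊,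
      ‖χ (n : ZMod D) * xiZero c' D j n d r / (n : ℂ) * conj (u (z₀ + Real.log n / Λ))‖
        ≤ B₁ * Z * (‖xiZero c' D j n d r‖ / n) := by
    intro n hn
    rw [Finset.mem_Ico] at hn
    have hn1 : 1 ≤ n := hn.1
    have hn0 : (0 : ℝ) < n := by exact_mod_cast hn1
    have hnx : (n : ℝ) < Real.exp (Z * Λ) := by
      have h := Nat.ceil_lt_add_one (Real.exp_pos (Z * Λ)).le
      have : (n : ℝ) + 1 ≤ ⌈Real.exp (Z * Λ)⌉₊ := by exact_mod_cast hn.2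
      linarith
    have hzn0 : 0 ≤ Real.log n / Λ := div_nonneg (Real.log_nonneg (by exact_mod_cast hn1)) hΛ0.le
    have hznZ : Real.log n / Λ ≤ Z := by
      rw [div_le_iff₀ hΛ0, ← Real.log_exp (Z * Λ)]; exact Real.log_le_log hn0 hnx.le
    have hmem : z₀ + Real.log n / Λ ∈ Icc 0 θ := ⟨by linarith, by linarith⟩
    have hu := hB _ hmem
    rw [norm_mul, norm_div, norm_mul, Complex.norm_conj, Complex.norm_natCast]
    calc ‖χ (n : ZMod D)‖ * ‖xiZero c' D j n d r‖ / n * ‖u (z₀ + Real.log n / Λ)‖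
        ≤ 1 * ‖xiZero c' D j n d r‖ / n * (B₁ * (θ - (z₀ + Real.log n / Λ))) := by
          gcongr; exact χ.norm_le_one _
      _ ≤ 1 * ‖xiZero c' D j n d r‖ / n * (B₁ * Z) := by
          gcongr; linarith
      _ = B₁ * Z * (‖xiZero c' D j n d r‖ / n) := by ring
  have hsum : ‖∑ n ∈ Finset.Ico 1 ⌈Real.exp (Z * Λ)⌉₊,
      χ (n : ZMod D) * xiZero c' D j n d r / (n : ℂ) * conj (u (z₀ + Real.log n / Λ))‖
        ≤ B₁ * Z * ∑ n ∈ Finset.Ico 1 ⌈Real.exp (Z * Λ)⌉₊, ‖xiZero c' D j n d r‖ / n := by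
    calc _ ≤ ∑ n ∈ Finset.Ico 1 ⌈Real.exp (Z * Λ)⌉₊, B₁ * Z * (‖xiZero c' D j n d r‖ / n) :=
          (norm_sum_le _ _).trans (sum_le_sum hterm)
      _ = _ := by rw [Finset.mul_sum]
  calc ‖χ (t : ZMod D)‖ * _ ≤ 1 * _ := mul_le_mul hχt hsum (norm_nonneg _) zero_le_one
    _ = _ := by rw [one_mul]

/-! ### The absolute logarithmic mean of `ξ₀ⱼ` up to `log x ≤ 𝓛²` -/

/-- **`Σ_{n<⌈x⌉} ‖ξ₀ⱼ(n;d,r)‖/n ≤ C·(1 + log x)³` for `1 ≤ x` with `log x ≤ 𝓛²`**, all large `D`, uniformly in `j, d, r`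
(the tree's `XiZeroMajorant.xiZeroTailMean_logFree` states this for `x ≤ T = e^{𝓛^{1.1}}`; its proof — the
Hall–Tenenbaum bound for the multiplicative majorant `g ≥ |ξ₀ⱼ|` with `B log p ≤ 1/8` on `p ≤ 2x` — uses only
`log x ≤ 𝓛²`, which is what the profile gathering needs up to `x = T²`).
[cite: Zhang2022LandauSiegel, §8 p.47 (display before (8.10)); §7 p.33] -/
theorem xiZeroLogMean_le (c' : ℝ) : ∃ C : ℝ, 0 ≤ C ∧ ForAllLarge fun D _ _ =>
    ∀ j d r : ℕ, ∀ x : ℝ, 1 ≤ x → Real.log x ≤ Real.log D ^ 2 →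
      ∑ n ∈ Finset.Ico 1 ⌈x⌉₊, ‖xiZero c' D j n d r‖ / n ≤ C * (1 + Real.log x) ^ 3 := by
  set C₀ : ℝ := Real.exp (4 * (3 : ℕ) + (129 / 4 + 5 * XiZeroMajorant.M0) * (36 * π) + XiZeroMajorant.M0 +
    XiZeroMajorant.C5 * LogEulerProduct.tailConst 4) with hC₀
  refine ⟨C₀, (Real.exp_pos _).le, ⌈Real.exp (5 * |c'| * π + 3)⌉₊, fun D _ χ hD _ _ j d r x hx1 hlogx' => ?_⟩
  obtain ⟨hL3, hBle⟩ := XiZeroMajorant.three_le_ell_and_Bsum_le hD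
  set ℓ := Skeleton.ell D with hℓ
  have hℓ1 : 1 ≤ ℓ := by linarith
  have hB0 := XiZeroMajorant.Bsum_nonneg c' D
  obtain ⟨hsmall8, hsmall36⟩ := XiZeroMajorant.Bsum_mul_le hL3 hBle
  have hx0 : 0 < x := by linarith
  have hlogx : Real.log x ≤ ℓ ^ 2 := hlogx'
  have hlogx0 : 0 ≤ Real.log x := Real.log_nonneg hx1
  have hlog2 : Real.log 2 ≤ 1 := by
    have := Real.log_le_sub_one_of_pos (show (0:ℝ) < 2 by norm_num); linarith
  have hBsmall : ∀ y : ℝ, Real.log y ≤ 3 + ℓ ^ 2 → XiZeroMajorant.Bsum c' D * Real.log y ≤ 1 / 8 := by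
    intro y hy
    calc XiZeroMajorant.Bsum c' D * Real.log y ≤ XiZeroMajorant.Bsum c' D * (3 + ℓ ^ 2) :=
          mul_le_mul_of_nonneg_left hy hB0
      _ ≤ 1 / 8 := hsmall8
  set X : ℕ := max ⌈x⌉₊ 2 with hXdef
  have hX2 : 2 ≤ X := le_max_right _ _
  have hXle : (X : ℝ) ≤ 2 * x := by
    rw [hXdef, Nat.cast_max]
    refine max_le ?_ (by push_cast; linarith)
    have := Nat.ceil_lt_add_one hx0.le
    linarith
  have hXpos : (0 : ℝ) < X := by exact_mod_cast (show 0 < X by omega)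
  have hlogX : Real.log X ≤ 1 + Real.log x := by
    calc Real.log X ≤ Real.log (2 * x) := Real.log_le_log hXpos hXle
      _ = Real.log 2 + Real.log x := Real.log_mul (by norm_num) hx0.ne'
      _ ≤ 1 + Real.log x := by linarith
  have hlogX0 : 0 ≤ Real.log X := Real.log_nonneg (by exact_mod_cast (show 1 ≤ X by omega))
  have hlog4X : Real.log (4 * X) ≤ 3 + ℓ ^ 2 := by
    have h8 : Real.log (4 * X) ≤ Real.log (8 * x) :=
      Real.log_le_log (by positivity) (by linarith)
    have h8' : Real.log (8 * x) = 3 * Real.log 2 + Real.log x := by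
      rw [Real.log_mul (by norm_num) hx0.ne', show (8 : ℝ) = 2 ^ 3 by norm_num, Real.log_pow]
      push_cast; ring
    linarith
  have hBp : ∀ p, p.Prime → p ≤ X → XiZeroMajorant.Bsum c' D * Real.log p ≤ 1 / 8 := by
    intro p hp hpX
    apply hBsmall
    have hp0 : (0 : ℝ) < p := by exact_mod_cast hp.pos
    calc Real.log p ≤ Real.log X := Real.log_le_log hp0 (by exact_mod_cast hpX)
      _ ≤ 1 + Real.log x := hlogX
      _ ≤ 3 + ℓ ^ 2 := by linarith
  have hterm : ∀ n ∈ Finset.Ico 1 ⌈x⌉₊,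
      ‖Skeleton.xiZero c' D j n d r‖ / n ≤ XiZeroMajorant.gMaj c' D n / n := by
    intro n hn
    obtain ⟨hn1, hnx⟩ := Finset.mem_Ico.mp hn
    have hn0 : n ≠ 0 := by omega
    have hnx' : (n : ℝ) < x := Nat.lt_ceil.mp hnx
    refine div_le_div_of_nonneg_right (XiZeroMajorant.norm_xiZero_le_gMaj c' D hn0 j d r fun q hq => ?_)
      (Nat.cast_nonneg n)
    apply hBsmall
    have hq0 : (0 : ℝ) < q := by exact_mod_cast (Nat.prime_of_mem_primeFactors hq).pos
    have hqn : (q : ℝ) ≤ n := by exact_mod_cast Nat.le_of_mem_primeFactors hq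
    calc Real.log q ≤ Real.log n := Real.log_le_log hq0 hqn
      _ ≤ Real.log x := Real.log_le_log (by exact_mod_cast (show 0 < n by omega)) hnx'.le
      _ ≤ 3 + ℓ ^ 2 := by linarith
  have hsub : Finset.Ico 1 ⌈x⌉₊ ⊆ Finset.Icc 1 X := by
    intro n hn
    obtain ⟨hn1, hnx⟩ := Finset.mem_Ico.mp hn
    exact Finset.mem_Icc.mpr ⟨hn1, by omega⟩
  have hmaj := XiZeroMajorant.sum_gMaj_div_le c' D hX2 hBp
  have hK0 : 0 ≤ 129 / 4 + 5 * XiZeroMajorant.M0 := by linarith [XiZeroMajorant.M0_nonneg]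
  have hexp : Real.exp (4 * (3 : ℕ) + (129 / 4 + 5 * XiZeroMajorant.M0) * XiZeroMajorant.Bsum c' D *
      Real.log (4 * X) + XiZeroMajorant.M0 + XiZeroMajorant.C5 * LogEulerProduct.tailConst 4) ≤ C₀ := by
    rw [hC₀]
    apply Real.exp_le_exp.mpr
    have : (129 / 4 + 5 * XiZeroMajorant.M0) * XiZeroMajorant.Bsum c' D * Real.log (4 * X)
        ≤ (129 / 4 + 5 * XiZeroMajorant.M0) * (36 * π) := by
      rw [mul_assoc]
      apply mul_le_mul_of_nonneg_left _ hK0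
      calc XiZeroMajorant.Bsum c' D * Real.log (4 * X) ≤ XiZeroMajorant.Bsum c' D * (3 + ℓ ^ 2) :=
            mul_le_mul_of_nonneg_left hlog4X hB0
        _ ≤ 36 * π := hsmall36
    linarith
  have hC₀0 : 0 ≤ C₀ := (Real.exp_pos _).le
  have hpow : Real.log X ^ (3 : ℕ) ≤ (1 + Real.log x) ^ 3 := pow_le_pow_left₀ hlogX0 hlogX 3
  calc ∑ n ∈ Finset.Ico 1 ⌈x⌉₊, ‖Skeleton.xiZero c' D j n d r‖ / n
      ≤ ∑ n ∈ Finset.Ico 1 ⌈x⌉₊, XiZeroMajorant.gMaj c' D n / n := sum_le_sum hterm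
    _ ≤ ∑ n ∈ Finset.Icc 1 X, XiZeroMajorant.gMaj c' D n / n :=
        sum_le_sum_of_subset_of_nonneg hsub fun n _ _ =>
          div_nonneg (XiZeroMajorant.gMaj_nonneg c' D n) (Nat.cast_nonneg n)
    _ ≤ _ := hmaj
    _ ≤ C₀ * (1 + Real.log x) ^ 3 := mul_le_mul hexp hpow (pow_nonneg hlogX0 3) hC₀0

end Literature.NumberTheory.LFunctions.Zhang2022.DipoleRule

end
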